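import Mathlib
import Summits.Ventures.HodgeRepro2.Hypothesis
import Summits.Ventures.HodgeRepro2.BallActionU21
import Summits.Ventures.HodgeRepro2.DefiniteUnitaryBounded
import Summits.Ventures.HodgeRepro2.BallStabilizerBounded

/-!
# Compact stabilisers: `U(2,1)` acts properly on the ball

`BallStabilizerBounded.lean` proved that the stabiliser in `U(2,1)` of a negative line has bounded
entries.  Since `U(2,1)` and the condition «`α` preserves the line `ℂ w`» are closed conditions on
`M_3(ℂ)`, the stabiliser is CLOSED and bounded, hence COMPACT (Heine–Borel in `ℂ⁹`).  This is the
classical form of the properness of the action of `U(2,1)` on `𝔹² = U(2,1)/(U(2) × U(1))` behind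
Shimura (J. Math. Soc. Japan 31 (1979), §4) and DR15 §2:

* `isClosed_setOf_isInU21` — `U(2,1)` is closed in `M_3(ℂ)`;
* `isClosed_setOf_mulVec_eq_smul` — the matrices preserving a line are closed;
* `lineStabilizer w` / `isCompact_lineStabilizer` — **the stabiliser in `U(2,1)` of a negative line
  is compact**;
* `IsInU21.ballAction_eq_self_iff` — `α ∈ U(2,1)` fixes `z ∈ 𝔹²` iff it preserves `ℂ · homog z`;
* `pointStabilizer z` / `isCompact_pointStabilizer` — **the stabiliser in `U(2,1)` of a point of
  the ball is compact**.
-/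

open Matrix

namespace Summit.Ventures.HodgeRepro2.ShimuraData

/-- `U(2,1)` is a closed subset of `M_3(ℂ)`. -/
theorem isClosed_setOf_isInU21 : IsClosed {α : Matrix (Fin 3) (Fin 3) ℂ | IsInU21 α} := by
  have h : Continuous fun α : Matrix (Fin 3) (Fin 3) ℂ => αᴴ * J21 * α :=
    (continuous_id.matrix_conjTranspose.matrix_mul continuous_const).matrix_mul continuous_id
  exact isClosed_eq h continuous_const

/-- The matrices carrying the line `ℂ w` into itself form a closed subset of `M_3(ℂ)`. -/
theorem isClosed_setOf_mulVec_eq_smul (w : Fin 3 → ℂ) :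
    IsClosed {α : Matrix (Fin 3) (Fin 3) ℂ | ∃ c : ℂ, α *ᵥ w = c • w} := by
  have h : {α : Matrix (Fin 3) (Fin 3) ℂ | ∃ c : ℂ, α *ᵥ w = c • w} =
      (fun α : Matrix (Fin 3) (Fin 3) ℂ => α *ᵥ w) ⁻¹'
        ((Submodule.span ℂ {w} : Submodule ℂ (Fin 3 → ℂ)) : Set (Fin 3 → ℂ)) := by
    ext α
    simp only [Set.mem_setOf_eq, Set.mem_preimage, SetLike.mem_coe, Submodule.mem_span_singleton]
    constructor
    · rintro ⟨c, hc⟩; exact ⟨c, hc.symm⟩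
    · rintro ⟨c, hc⟩; exact ⟨c, hc.symm⟩
  rw [h]
  exact (Submodule.closed_of_finiteDimensional _).preimage
    (continuous_id.matrix_mulVec continuous_const)

/-- The stabiliser in `U(2,1)` of the line `ℂ w`. -/
def lineStabilizer (w : Fin 3 → ℂ) : Set (Matrix (Fin 3) (Fin 3) ℂ) :=
  {α | IsInU21 α ∧ ∃ c : ℂ, α *ᵥ w = c • w}

/-- The stabiliser of a line is closed. -/
theorem isClosed_lineStabilizer (w : Fin 3 → ℂ) : IsClosed (lineStabilizer w) :=
  isClosed_setOf_isInU21.inter (isClosed_setOf_mulVec_eq_smul w)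

/-- **The stabiliser in `U(2,1)` of a negative line is compact.** -/
theorem isCompact_lineStabilizer {w : Fin 3 → ℂ} (hw : hermJ21 w < 0) :
    IsCompact (lineStabilizer w) := by
  obtain ⟨C, hC⟩ := exists_entry_bound_of_mulVec_eq_smul hw
  have hbox : IsCompact (Set.univ.pi fun _ : Fin 3 => Set.univ.pi fun _ : Fin 3 =>
      Metric.closedBall (0 : ℂ) C) :=
    isCompact_univ_pi fun _ => isCompact_univ_pi fun _ => isCompact_closedBall 0 C
  refine hbox.of_isClosed_subset (isClosed_lineStabilizer w) ?_
  rintro α ⟨hα, hc⟩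
  refine Set.mem_univ_pi.mpr fun i => Set.mem_univ_pi.mpr fun j => ?_
  rw [Metric.mem_closedBall, dist_zero_right]
  exact hC α hα hc i j

/-- `normalizeJ` is invariant under non-zero scalars. -/
theorem normalizeJ_smul {c : ℂ} (hc : c ≠ 0) (v : Fin 3 → ℂ) : normalizeJ (c • v) = normalizeJ v := by
  funext k
  unfold normalizeJ
  simp only [Pi.smul_apply, smul_eq_mul]
  rw [mul_div_mul_left _ _ hc]

/-- `normalizeJ (homog z) = z`. -/
theorem normalizeJ_homog (z : Fin 2 → ℂ) : normalizeJ (homog z) = z := by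
  funext k
  unfold normalizeJ
  rw [homog_castSucc, homog_last, div_one]

/-- `α ∈ U(2,1)` fixes `z ∈ 𝔹²` iff it carries the line `ℂ · homog z` into itself. -/
theorem IsInU21.ballAction_eq_self_iff {α : Matrix (Fin 3) (Fin 3) ℂ} (hα : IsInU21 α)
    {z : Fin 2 → ℂ} (hz : z ∈ ball₂) :
    ballAction α z = z ↔ ∃ c : ℂ, α *ᵥ homog z = c • homog z := by
  refine ⟨hα.exists_mulVec_homog_eq_smul_of_ballAction_eq hz, ?_⟩
  rintro ⟨c, hc⟩
  have hne := hα.mulVec_homog_last_ne_zero hz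
  have hc0 : c ≠ 0 := by
    rintro rfl
    rw [zero_smul] at hc
    exact hne (by rw [hc]; rfl)
  rw [ballAction_eq_normalizeJ, hc, normalizeJ_smul hc0, normalizeJ_homog]

/-- The stabiliser in `U(2,1)` of a point `z` of the ball. -/
def pointStabilizer (z : Fin 2 → ℂ) : Set (Matrix (Fin 3) (Fin 3) ℂ) :=
  {α | IsInU21 α ∧ ballAction α z = z}

/-- For `z ∈ 𝔹²`, the point stabiliser is the stabiliser of the negative line `ℂ · homog z`. -/
theorem pointStabilizer_eq_lineStabilizer {z : Fin 2 → ℂ} (hz : z ∈ ball₂) :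
    pointStabilizer z = lineStabilizer (homog z) := by
  ext α
  simp only [pointStabilizer, lineStabilizer, Set.mem_setOf_eq]
  constructor
  · rintro ⟨hα, h⟩; exact ⟨hα, (hα.ballAction_eq_self_iff hz).mp h⟩
  · rintro ⟨hα, h⟩; exact ⟨hα, (hα.ballAction_eq_self_iff hz).mpr h⟩

/-- **The stabiliser in `U(2,1)` of a point of the ball is compact** (`U(2,1)` acts properly on
`𝔹²`). -/
theorem isCompact_pointStabilizer {z : Fin 2 → ℂ} (hz : z ∈ ball₂) :
    IsCompact (pointStabilizer z) := by
  rw [pointStabilizer_eq_lineStabilizer hz]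
  exact isCompact_lineStabilizer ((mem_ball₂_iff_hermJ21_homog_neg z).mp hz)

end Summit.Ventures.HodgeRepro2.ShimuraData
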